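import Summits.QuantumFields.BalabanUV.T4Continuum.Support.NE7SupLiftFloor
import HarnessLib

/-!
# NE7SupLiftLevelMasses — THE SUP-NORM ROUTE TO (G′), MULTIPLIER SIDE: for a fine field with the Bałaban-scaled sup bound `‖X̃(b)‖ ≤ σ·L^{−(j+1)}` over a class configuration, EVERY
# linearised level average obeys `‖dirIter_i X̃‖ ≤ 51·L^i·σ·L^{−(j+1)}` (row NE3's ✓ `NE3LinearisedAverageSup.norm_dirIter_le_sup`, re-indexed to every level), so the geometrically
# weighted LEVEL MASSES of row NE7b's (G3) letter ✓ `multiplierTerm_le_levelMasses` obey `Σ_{i≤j} K·(L∕L⁴)^{j−i}·dirSq (dirIter_i X̃) [0,N·L^{j+1−i})⁴ ≤ 8·51²·K·L²·N⁴·σ²` — j-UNIFORM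
# (d = 4; lineage `b2b-balaban-t4-ne7-p1`, gen 118, file G16; memo ROAD-G118 §5 (S3))

Cell `pub-balaban`, rung (B)+1 sub-cell t4, CRUX PROVER NE7 #1 (OWNER of row NE7), generation 118.  WHAT ([folklore]; 0 def, 0 sorry; `d = 4`): `tower_mul_pow_eq` (re-indexing of the tower period),
**`norm_dirIter_le_sup_level`** (the sup letter at every level `i ≤ j+1` of one base), `levelMass_le_of_sup` (`dirSq (dirIter_i X̃) (periodBox (N·L^{j+1−i})) ≤ 4·51²·N⁴·σ²·L^{2(j+1−i)}`),
**`weightedLevelMasses_le_of_sup`** (the displayed geometric sum, any weight constant `K ≥ 0`).  With G15 (the Hessian half) and gen 115∕row NE7b's all-data packages this closes (G′) in sup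
currency MODULO ONE ESTIMATE: the k-uniform ℓ^∞ bound of the minimising lift (next file).
HONEST FRAMING: kinematics over landed kernel theorems about OUR objects; the sup bound is a displayed hypothesis; nothing of Bałaban's asserted ([Balaban1985Averaging] (45)–(48), (110)–(125)
context); NOT (G′), NOT NE7 as a spine node; spine 0∕9; finite T⁴ rung (B)+1 — NOT infinite volume, NOT mass gap, NOT BetaPertH, NOT Clay.
-/

set_option autoImplicit false

open scoped BigOperators Matrix Matrix.Norms.L2Operator
open NormedSpace Finset

namespace Summit.QuantumFields.BalabanUV.T4Continuum.NE7SupLiftLevelMasses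

open Literature.MathematicalPhysics.QuantumFieldTheory.Balaban1983to89
open B7Prop1Explicit B7Prop2Explicit MatrixLog UnitaryModel
open T4AveragingDeficitWall (IsUnitaryCfg IsSkewDir SmallField dirSq)
open T4AveragingDeficitWallBoundary (IsPeriodicCfg periodBox card_periodBox)
open AveragingDeficitPeriodicCounting (IsPeriodicDir)
open AveragingDeficitMultiLevelPrep (cavgIter tower tower_ne_zero LevelSmall)
open NE3TangentCovariantTower (dirIter dirIter_zero)
open NE3EnergyHessContTwoTerm (dirSq_nonneg)
open NE3FramePotBoundW (levelSmall_of_le)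
open NE3LinearisedAverageSup (curv curvSum curvSum_mono norm_dirIter_le_sup)
open NE3EnergyRateWSupOfSlicePoincare (tower_eq_mul_pow)
open NE7RadIterUniform (geom_sum_le_two)
open NE7SupLiftFloor (dirSq_periodBox_le_of_sup)

noncomputable section

variable {n : Type*} [Fintype n] [DecidableEq n]

omit [Fintype n] [DecidableEq n] in
/-- Re-indexing of the tower period: `tower L (N·L^{k−i}) i = tower L N k` for `i ≤ k`. [folklore] -/
theorem tower_mul_pow_eq (L N : ℕ) {i k : ℕ} (hik : i ≤ k) : tower L (N * L ^ (k - i)) i = tower L N k := by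
  rw [tower_eq_mul_pow, tower_eq_mul_pow, mul_assoc, ← pow_add, Nat.sub_add_cancel hik]

/-- **THE SUP LETTER AT EVERY LEVEL OF ONE BASE** (`d = 4`, `L ≥ 2`; base `U` unitary, `(tower L N (j+1))`-periodic, `0 ≤ x`, `LevelSmall 4 L j x`, `SmallField U x`, curvature line
`curvSum 4 L (j+1) x ≤ (2∕3)·L`; `Y` skew, `(tower L N (j+1))`-periodic, `‖Y‖ ≤ s`): `‖dirIter L i U Y z κ‖ ≤ 51·L^i·s` for every `i ≤ j+1`. [folklore] -/
theorem norm_dirIter_le_sup_level [Nonempty n] {L N : ℕ} [NeZero N] (hL : 2 ≤ L) (j : ℕ) {U : Site 4 → Fin 4 → (Matrix n n ℂ)ˣ} {x : ℝ}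
    (hU : IsUnitaryCfg U) (hUP : IsPeriodicCfg U ((tower L N (j + 1) : ℕ) : ℤ)) (hx : 0 ≤ x) (hs : LevelSmall 4 L j x) (hUx : SmallField U x)
    (hA : curvSum 4 L (j + 1) x ≤ 2 / 3 * L) {Y : Site 4 → Fin 4 → Matrix n n ℂ} (hYs : IsSkewDir Y) (hYP : IsPeriodicDir Y ((tower L N (j + 1) : ℕ) : ℤ))
    {s : ℝ} (hs0 : 0 ≤ s) (hY : ∀ (z : Site 4) (μ : Fin 4), ‖Y z μ‖ ≤ s) {i : ℕ} (hi : i ≤ j + 1) (z : Site 4) (κ : Fin 4) :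
    ‖dirIter L i U Y z κ‖ ≤ 51 * (L : ℝ) ^ i * s := by
  have hL0 : (0 : ℝ) < L := by exact_mod_cast (show 0 < L by omega)
  rcases Nat.eq_zero_or_pos i with h0 | hpos
  · subst h0
    rw [dirIter_zero, pow_zero, mul_one]
    have := hY z κ
    linarith
  · obtain ⟨i', rfl⟩ : ∃ i', i = i' + 1 := ⟨i - 1, by omega⟩
    -- the base at level `i'+1 ≤ j+1`: period `tower L (N·L^{j+1−(i'+1)}) (i'+1)`, `LevelSmall i'`, curvature line for `i'+1` levels
    haveI : NeZero (N * L ^ (j + 1 - (i' + 1))) := ⟨Nat.mul_ne_zero (NeZero.ne N) (pow_ne_zero _ (by omega))⟩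
    have hT : tower L (N * L ^ (j + 1 - (i' + 1))) (i' + 1) = tower L N (j + 1) := tower_mul_pow_eq L N hi
    have hUP' : IsPeriodicCfg U ((tower L (N * L ^ (j + 1 - (i' + 1))) (i' + 1) : ℕ) : ℤ) := by rw [hT]; exact hUP
    have hYP' : IsPeriodicDir Y ((tower L (N * L ^ (j + 1 - (i' + 1))) (i' + 1) : ℕ) : ℤ) := by rw [hT]; exact hYP
    have hs' : LevelSmall 4 L i' x := levelSmall_of_le (by omega) hs
    have hA' : curvSum 4 L (i' + 1) x ≤ 2 / 3 * L := (curvSum_mono (d := 4) L hi hx).trans hA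
    have h := norm_dirIter_le_sup (d := 4) hL i' hU hUP' hx hs' hUx hYs hYP' hs0 hY hA' z κ
    refine h.trans ?_
    have : (3 + 12 * ((4 : ℕ) : ℝ)) = 51 := by norm_num
    rw [this]

/-- **ONE LEVEL MASS FROM THE SUP BOUND** (`d = 4`): under the hypotheses of `norm_dirIter_le_sup_level` with `s = σ·(L⁻¹)^{j+1}`, for `i ≤ j+1`:
`dirSq (dirIter L i U Y) (periodBox (N·L^{j+1−i})) ≤ 4·51²·N⁴·σ²·L^{2(j+1−i)}`. [folklore] -/
theorem levelMass_le_of_sup [Nonempty n] {L N : ℕ} [NeZero N] (hL : 2 ≤ L) (j : ℕ) {U : Site 4 → Fin 4 → (Matrix n n ℂ)ˣ} {x : ℝ}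
    (hU : IsUnitaryCfg U) (hUP : IsPeriodicCfg U ((tower L N (j + 1) : ℕ) : ℤ)) (hx : 0 ≤ x) (hs : LevelSmall 4 L j x) (hUx : SmallField U x)
    (hA : curvSum 4 L (j + 1) x ≤ 2 / 3 * L) {Y : Site 4 → Fin 4 → Matrix n n ℂ} (hYs : IsSkewDir Y) (hYP : IsPeriodicDir Y ((tower L N (j + 1) : ℕ) : ℤ))
    {σ : ℝ} (hσ : 0 ≤ σ) (hY : ∀ (z : Site 4) (μ : Fin 4), ‖Y z μ‖ ≤ σ * ((L : ℝ)⁻¹) ^ (j + 1)) {i : ℕ} (hi : i ≤ j + 1) :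
    dirSq (dirIter L i U Y) (periodBox (N * L ^ (j + 1 - i))) ≤ 4 * 51 ^ 2 * (N : ℝ) ^ 4 * σ ^ 2 * ((L : ℝ) ^ (j + 1 - i)) ^ 2 := by
  have hL0 : (0 : ℝ) < L := by exact_mod_cast (show 0 < L by omega)
  have hs0 : 0 ≤ σ * ((L : ℝ)⁻¹) ^ (j + 1) := by positivity
  have hsup : ∀ (z : Site 4) (κ : Fin 4), ‖dirIter L i U Y z κ‖ ≤ 51 * (L : ℝ) ^ i * (σ * ((L : ℝ)⁻¹) ^ (j + 1)) :=
    fun z κ => norm_dirIter_le_sup_level hL j hU hUP hx hs hUx hA hYs hYP hs0 hY hi z κ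
  have h := dirSq_periodBox_le_of_sup (dirIter L i U Y) (N * L ^ (j + 1 - i)) hsup
  refine h.trans (le_of_eq ?_)
  push_cast
  -- `L^i · L^{−(j+1)} = (L^{j+1−i})⁻¹`
  have e : (L : ℝ) ^ i * ((L : ℝ)⁻¹) ^ (j + 1) = ((L : ℝ) ^ (j + 1 - i))⁻¹ := by
    have hsplit : (L : ℝ) ^ (j + 1) = (L : ℝ) ^ (j + 1 - i) * (L : ℝ) ^ i := by rw [← pow_add, Nat.sub_add_cancel hi]
    rw [inv_pow, hsplit, mul_inv, ← mul_assoc, mul_comm ((L : ℝ) ^ i), mul_assoc, mul_inv_cancel₀ (pow_ne_zero _ hL0.ne'), mul_one]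
  have hM0 : (0 : ℝ) < (L : ℝ) ^ (j + 1 - i) := by positivity
  calc ((N : ℝ) * (L : ℝ) ^ (j + 1 - i)) ^ 4 * (4 : ℝ) * (51 * (L : ℝ) ^ i * (σ * ((L : ℝ)⁻¹) ^ (j + 1))) ^ 2
      = ((N : ℝ) * (L : ℝ) ^ (j + 1 - i)) ^ 4 * 4 * (51 * σ * ((L : ℝ) ^ i * ((L : ℝ)⁻¹) ^ (j + 1))) ^ 2 := by ring
    _ = ((N : ℝ) * (L : ℝ) ^ (j + 1 - i)) ^ 4 * 4 * (51 * σ * ((L : ℝ) ^ (j + 1 - i))⁻¹) ^ 2 := by rw [e]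
    _ = 4 * 51 ^ 2 * (N : ℝ) ^ 4 * σ ^ 2 * ((L : ℝ) ^ (j + 1 - i)) ^ 2 * (((L : ℝ) ^ (j + 1 - i)) * ((L : ℝ) ^ (j + 1 - i))⁻¹) ^ 2 := by ring
    _ = 4 * 51 ^ 2 * (N : ℝ) ^ 4 * σ ^ 2 * ((L : ℝ) ^ (j + 1 - i)) ^ 2 := by rw [mul_inv_cancel₀ hM0.ne', one_pow, mul_one]

/-- **THE WEIGHTED LEVEL MASSES FROM THE SUP BOUND** (`d = 4`, `L ≥ 2`; the sum of row NE7b's ✓ `multiplierTerm_le_levelMasses` with `m = j`, any weight constant `K ≥ 0`):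
`Σ_{i<j+1} (K·(L∕L⁴)^{j−i})·dirSq (dirIter L i U Y) (periodBox (N·L^{j−i+1})) ≤ 8·51²·K·L²·N⁴·σ²`. [folklore] -/
theorem weightedLevelMasses_le_of_sup [Nonempty n] {L N : ℕ} [NeZero N] (hL : 2 ≤ L) (j : ℕ) {U : Site 4 → Fin 4 → (Matrix n n ℂ)ˣ} {x : ℝ}
    (hU : IsUnitaryCfg U) (hUP : IsPeriodicCfg U ((tower L N (j + 1) : ℕ) : ℤ)) (hx : 0 ≤ x) (hs : LevelSmall 4 L j x) (hUx : SmallField U x)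
    (hA : curvSum 4 L (j + 1) x ≤ 2 / 3 * L) {Y : Site 4 → Fin 4 → Matrix n n ℂ} (hYs : IsSkewDir Y) (hYP : IsPeriodicDir Y ((tower L N (j + 1) : ℕ) : ℤ))
    {σ : ℝ} (hσ : 0 ≤ σ) (hY : ∀ (z : Site 4) (μ : Fin 4), ‖Y z μ‖ ≤ σ * ((L : ℝ)⁻¹) ^ (j + 1)) {K : ℝ} (hK : 0 ≤ K) :
    ∑ i ∈ Finset.range (j + 1), (K * ((L : ℝ) / (L : ℝ) ^ 4) ^ (j - i)) * dirSq (dirIter L i U Y) (periodBox (N * L ^ (j - i + 1)))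
      ≤ 8 * 51 ^ 2 * K * (L : ℝ) ^ 2 * (N : ℝ) ^ 4 * σ ^ 2 := by
  have hL0 : (0 : ℝ) < L := by exact_mod_cast (show 0 < L by omega)
  have hq0 : 0 ≤ (L : ℝ)⁻¹ := by positivity
  have hq2 : (L : ℝ)⁻¹ ≤ 1 / 2 := by
    rw [inv_eq_one_div]; exact one_div_le_one_div_of_le (by norm_num) (by exact_mod_cast hL)
  -- each term is `≤ 4·51²·K·L²·N⁴σ²·(L⁻¹)^{j−i}`
  have hterm : ∀ i ∈ Finset.range (j + 1), (K * ((L : ℝ) / (L : ℝ) ^ 4) ^ (j - i)) * dirSq (dirIter L i U Y) (periodBox (N * L ^ (j - i + 1)))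
      ≤ 4 * 51 ^ 2 * K * (L : ℝ) ^ 2 * (N : ℝ) ^ 4 * σ ^ 2 * ((L : ℝ)⁻¹) ^ (j - i) := by
    intro i hi
    have hij : i ≤ j := Nat.lt_succ_iff.mp (Finset.mem_range.mp hi)
    have e1 : j - i + 1 = j + 1 - i := by omega
    have hm := levelMass_le_of_sup hL j hU hUP hx hs hUx hA hYs hYP hσ hY (i := i) (by omega)
    rw [← e1] at hm
    have hw0 : 0 ≤ K * ((L : ℝ) / (L : ℝ) ^ 4) ^ (j - i) := by positivity
    refine (mul_le_mul_of_nonneg_left hm hw0).trans (le_of_eq ?_)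
    -- `(L∕L⁴)^{j−i}·(L^{j−i+1})² = L²·(L⁻¹)^{j−i}`
    have e2 : ((L : ℝ) / (L : ℝ) ^ 4) = ((L : ℝ)⁻¹) ^ 3 := by
      field_simp
    rw [e2]
    have e3 : (((L : ℝ)⁻¹) ^ 3) ^ (j - i) * ((L : ℝ) ^ (j - i + 1)) ^ 2 = (L : ℝ) ^ 2 * ((L : ℝ)⁻¹) ^ (j - i) * (((L : ℝ)⁻¹ * L) ^ (j - i)) ^ 2 := by ring
    calc K * (((L : ℝ)⁻¹) ^ 3) ^ (j - i) * (4 * 51 ^ 2 * (N : ℝ) ^ 4 * σ ^ 2 * ((L : ℝ) ^ (j - i + 1)) ^ 2)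
        = 4 * 51 ^ 2 * K * (N : ℝ) ^ 4 * σ ^ 2 * ((((L : ℝ)⁻¹) ^ 3) ^ (j - i) * ((L : ℝ) ^ (j - i + 1)) ^ 2) := by ring
      _ = 4 * 51 ^ 2 * K * (N : ℝ) ^ 4 * σ ^ 2 * ((L : ℝ) ^ 2 * ((L : ℝ)⁻¹) ^ (j - i) * (((L : ℝ)⁻¹ * L) ^ (j - i)) ^ 2) := by rw [e3]
      _ = 4 * 51 ^ 2 * K * (L : ℝ) ^ 2 * (N : ℝ) ^ 4 * σ ^ 2 * ((L : ℝ)⁻¹) ^ (j - i) := by rw [inv_mul_cancel₀ hL0.ne', one_pow, one_pow, mul_one]; ring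
  calc ∑ i ∈ Finset.range (j + 1), (K * ((L : ℝ) / (L : ℝ) ^ 4) ^ (j - i)) * dirSq (dirIter L i U Y) (periodBox (N * L ^ (j - i + 1)))
      ≤ ∑ i ∈ Finset.range (j + 1), 4 * 51 ^ 2 * K * (L : ℝ) ^ 2 * (N : ℝ) ^ 4 * σ ^ 2 * ((L : ℝ)⁻¹) ^ (j - i) := Finset.sum_le_sum hterm
    _ = 4 * 51 ^ 2 * K * (L : ℝ) ^ 2 * (N : ℝ) ^ 4 * σ ^ 2 * ∑ i ∈ Finset.range (j + 1), ((L : ℝ)⁻¹) ^ (j - i) := by rw [Finset.mul_sum]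
    _ = 4 * 51 ^ 2 * K * (L : ℝ) ^ 2 * (N : ℝ) ^ 4 * σ ^ 2 * ∑ i ∈ Finset.range (j + 1), ((L : ℝ)⁻¹) ^ i := by
        rw [← Finset.sum_range_reflect (fun i => ((L : ℝ)⁻¹) ^ i) (j + 1)]
        congr 1
    _ ≤ 4 * 51 ^ 2 * K * (L : ℝ) ^ 2 * (N : ℝ) ^ 4 * σ ^ 2 * 2 := mul_le_mul_of_nonneg_left (geom_sum_le_two hq0 hq2 (j + 1)) (by positivity)
    _ = 8 * 51 ^ 2 * K * (L : ℝ) ^ 2 * (N : ℝ) ^ 4 * σ ^ 2 := by ring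

end

end Summit.QuantumFields.BalabanUV.T4Continuum.NE7SupLiftLevelMasses
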